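import Literature.MathematicalPhysics.QuantumFieldTheory.Balaban1983to89.B4ThmZeroNestAlphaZero
import Literature.MathematicalPhysics.QuantumFieldTheory.Balaban1983to89.B4Lemma24ZeroBoxAlphaNeg

/-!
# `Balaban1983to89.B4RuledReadings` — the REFEREE's RULING G-ref1-32 «B4-RETYPE: yes» booked under the `B4`
# namespace: the FAITHFUL readings of [B4]'s Theorem p. 573 and Lemma 2.4 (2.36) are the cell's ALREADY-PROVED
# restricted leaves `ThmPrintedNN` (Hölder range `0 ≤ α < 1`, on the BOND carriers of `D^η_A`) and
# `Lemma24PrintedNN` (`0 ≤ α < 1`), re-exposed here BY NAME; the typed leaves `B4.ThmPrinted` / `B4.Lemma24Printed`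
# (literal «α < 1», site-difference carriers) stay untouched as the cell's quoted transcriptions (S1, ADDITIVE —
# `B4.lean` is NOT edited; no importer re-verifies)

**Source.** T. Bałaban, *Regularity and decay of lattice Green's functions*, Commun. Math. Phys. **89** (1983) 571–597
[`Balaban1983RegularityDecay`] (= B4): p. 572 (1.3) (the covariant difference derivative `D^η_{A,μ}` on bonds
`⟨x, x + ηe_μ⟩ ⊂ Ω`), p. 573 the Theorem («Proposition 2.1 of [1]») with (1.9)–(1.12), p. 577 (2.14) (the Hölder norm),
p. 582 Lemma 2.4 (2.35)–(2.37).  Renders `b2b-balaban-ref1/pages/1983-cmp89-regularity-decay/…-p002/p003/p012-x2.png`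
were read as images by the referee (ruling below); this module types NO new quotation.

## THE RULING (cell journal `HOME/CLAIMS.log` l.1288, 2026-08-19T20:40:30Z, boundary referee `b2b-balaban-ref1-g87`,
## answering the carver's REQUEST l.712 «B4-RETYPE»; verbatim)

«RULING G-ref1-32 = «B4-RETYPE: yes» for both items — (1) Theorem p. 573 Hölder clause: CARRIER transcription defect
(print (1.3) D^η_A lives on bonds with both end-points in Ω; b04's `zeroFieldSettingB` `fdiff := 0` off-bond extension
is not print's; faithful carrier = bond-guarded `zeroFieldSettingBond`/`nestFam`; NB print's (1.9) pair x, x′ is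
ARBITRARY, not nearest-neighbour); (2) «α < 1» (Theorem; Lemma 2.4 (2.36)): typed VERBATIM, the α < 0 range is an
elided standing Hölder convention at print level (B5 (1.113) writes «0 ≤ α < 1»); faithful range 0 ≤ α < 1 (α = 0 is
(2.35) with c₁ = 2c₀). S1 ADDITIVE suffices (re-expose `ThmPrintedNN` on bond carriers + `Lemma24PrintedNN` by name,
docstring flags); S3 in-place `B4.lean` v2 NOT required.»

Division of labour (carver ACK + INTENT l.1324): this S1 module is the TEMPLATE's (one-writer of `B4*.lean` since the
operator RULING `HOME/BOARD.jsonl` l.4219); the carver's `DagDischargedII` v6 re-points the DAG leaf `b4` conjunct 1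
onto the ruled reading BY NAME.

## WHAT THIS MODULE DOES (bookkeeping only; every mathematical fact below is an EXISTING kernel theorem of the tree,
## cited BY NAME — pv17 nodes 12/13/16/17/18 for the Theorem, nodes 21/22 for Lemma 2.4)

* §1 **THE RULED NAMES UNDER `B4`** — `export` ALIASES (no new declaration, no restatement; ABSOLUTE RULE):
  `B4.ThmPrintedNN` := `B4Ineq111ZeroNestEta.ThmPrintedNN` (node 13: the typed leaf `B4.ThmPrinted` with the binder
  `0 ≤ α` inserted, BOTH conjuncts `Ineq19_110 ∧ Ineq111_112`, every other token verbatim) and `B4.Lemma24PrintedNN` :=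
  `B4Lemma24ZeroBoxScale.Lemma24PrintedNN` (node 21: `B4.Lemma24Printed` with `0 ≤ α →` inserted in its (2.36)
  conjunct); also the restriction maps `B4.thmPrintedNN_of_thmPrinted`, `B4.lemma24PrintedNN_of_printed`.  After
  `import …B4RuledReadings` the names `B4.ThmPrintedNN`, `B4.Lemma24PrintedNN` resolve (to the node 13 / node 21
  constants).  THE CARRIER HALF of item (1) is a property of the INSTANTIATION of the abstract carrier `B4.EtaSetting`
  (whose fields `lhs19`/`dlhs19` are abstract functionals): the ruled instantiation of `D^η_{A,μ}` is the bond-guarded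
  one — at zero field `B4Ineq19ZeroBoxEta.zeroFieldSettingBond` (`holderQ`: the two-point Hölder quotient of (1.9) is
  formed only when BOTH forward bonds `⟨x, x+ηe_μ⟩`, `⟨x′, x′+ηe_μ⟩` lie in `Ω`, the pair `x, x′` itself arbitrary), NOT
  b04's `B4Cor23ZeroEta.zeroFieldSettingB` (`fdiff := 0` off-bond extension).  For `A ≠ 0` no instantiation exists in
  the tree; any future one is to be bond-guarded in the same sense (this is the content of the ruling to carry).
* §2 **PROJECTIONS** (new one-line theorems, dot-notation on the printed names): `ThmPrinted.nn`, `ThmPrintedNN.clause`,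
  `thmPrintedNN_iff`, `Lemma24Printed.nn`, `Lemma24Printed.bounds235_237`, `Lemma24Printed.bound236_nn`,
  `Lemma24PrintedNN.bound236` — the typed leaves IMPLY the ruled ones for every family (the ruled leaves are
  weakenings, not new statements), and the `0 ≤ α < 1` clauses are extracted by name.
* §3 **THE RULING'S LEDGER AT ZERO FIELD, BY NAME** (new packaging theorems; every conjunct an existing theorem):
  `ruling_thm573_nestFam` (nested boxes `Ω ⊂ Ω₀`, admissible `0 ≤ g ≤ dist_η(supp f, Ω₀∖Ω)`): the RULED reading
  `ThmPrintedNN (nestFam …)` is PROVED (node 13 `thmPrintedNN_nestFam`) ∧ on b04's verbatim carrier `nestFamB` BOTH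
  `ThmPrintedNN` and `ThmPrinted` are REFUTED (node 17 `not_thmPrintedNN_nestFamB` / `not_thmPrinted_nestFamB` — the
  carrier defect, item (1)); `ruling_thm573_boxFam` (boxes): the LITERAL typed leaf `ThmPrinted` («∀ α < 1») is REFUTED
  in BOTH conventions (node 16 `not_thmPrinted_boxFam` / `not_thmPrinted_boxFamB`, α = −1 — the range defect, item
  (2)) while `ThmPrintedNN (boxFam …)` holds; `ruling_thm573_allInstances` (b04's own index `ZeroFieldInstance d`, all
  regions): `¬ ThmPrinted` in both conventions (node 16) ∧ `¬ ThmPrintedNN (zeroFieldSettingB …)` (node 17);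
  `ruling_thm573_transfer` = node 18 `thmPrintedNN_bond_of_B` (verbatim ⇒ bond at every α, every index);
  `ruling_lemma24_zeroFieldScales`: `Lemma24PrintedNN (zeroFieldScales …)` PROVED (node 21) ∧
  `¬ Lemma24Printed (zeroFieldScales …)` (node 22, α = −1).  Non-vacuity `example`s at `d + 1 = 4`.

## DECISIONS RECORDED (template, one-writer)

* `B4.lean` (b04 g1, p176330) is NOT edited: `ThmPrinted`, `Lemma24Printed`, `Lemma22Printed`, … keep their bytes and
  every importer (`DagBinding*`, `DagDischarged*`, `B5Ineq113`, pv17 nodes) is untouched (ruling: «S3 … NOT required»).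
* `B5Ineq113.h113_of_display136` (the one tree consumer of `B4.Lemma24Printed`'s (2.36) clause) is NOT migrated in
  this module: its proof uses the clause only at `0 ≤ α` (the chosen `c₁(α)` enters `ineq113At_of_display136` under
  `hα0 : 0 ≤ α`), so a variant from `Lemma24PrintedNN` is a mechanical rewrite of that one proof inside `B5Ineq113.lean`
  — available from the template ON REQUEST (no DAG conjunct depends on it; recorded in the journal LANDED line).
* Nothing here is a claim about the printed Theorem at `A ≠ 0` or on general big-block regions: the ruled reading is
  PROVED only where the tree proves it (zero field, nested boxes / boxes); elsewhere it is the cell's QUOTED leaf, now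
  under the name `B4.ThmPrintedNN` with the bond-carrier proviso of §1.

RECORDS: GAPS G-ref1-32 (ruling), C-carver-g14-* (v6), C-tmpl28-2 (this module).  NOT summit progress; NOT a statement
against [B4]; NOT continuum; NOT Clay.  Unit `b2b-balaban-template` gen 28 (journal CLAIM B4-RETYPE-S1).
-/

namespace Literature.MathematicalPhysics.QuantumFieldTheory.Balaban1983to89.B4

open B4Cor23Zero (supp)
open B4Cor23ZeroDelta (bdist outR)
open B4Cor23ZeroEta (ZeroFieldInstance zeroFieldSettingB zeroFieldSetting)
open B4Ineq19ZeroBoxEta (zeroFieldSettingBond BoxInst boxFam boxFamB thmPrinted19NN_boxFam)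
open B4Ineq111ZeroNestEta (NestInst nestFam nestFamB thmPrintedNN_nestFam bdist_admissible
  thmPrinted19NN_of_thmPrintedNN)
open B4Thm19ZeroBoxNegAlpha (not_thmPrinted_boxFam not_thmPrinted_boxFamB not_thmPrinted_zeroFieldSettingB
  not_thmPrinted_zeroFieldSettingBond)
open B4Ineq112ZeroNestNegFace (not_thmPrintedNN_nestFamB not_thmPrinted_nestFamB not_thmPrintedNN_zeroFieldSettingB
  bdist_nonneg)
open B4ThmZeroNestAlphaZero (thmPrintedNN_bond_of_B thmPrinted_bond_of_B)
open B4Lemma24ZeroBoxScale (ScaleIdx zeroFieldScales lemma24PrintedNN_zeroFieldScales)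
open B4Lemma24ZeroBoxAlphaNeg (not_lemma24Printed_zeroFieldScales)

/-! ## §1 The ruled names under `B4` (aliases of the node 13 / node 21 constants; no new declaration) -/

export B4Ineq111ZeroNestEta (ThmPrintedNN thmPrintedNN_of_thmPrinted)
export B4Lemma24ZeroBoxScale (Lemma24PrintedNN lemma24PrintedNN_of_printed)

/-! ## §2 Projections: the typed leaves imply the ruled ones; the `0 ≤ α < 1` clauses by name -/

section Projections

variable {I : Type}

/-- **RULED READING OF THE THEOREM p. 573, AS A WEAKENING OF THE TYPED LEAF**: `B4.ThmPrinted fam → B4.ThmPrintedNN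
fam` for every family (drop the instances `α < 0` of the literal binder «α < 1»; RULING G-ref1-32 item (2)).
[cite: Balaban1983RegularityDecay, Theorem p. 573 (1.9)–(1.12); Hölder range 0 ≤ α < 1 per ruling G-ref1-32] -/
theorem ThmPrinted.nn {fam : I → EtaSetting} (h : ThmPrinted fam) : ThmPrintedNN fam :=
  thmPrintedNN_of_thmPrinted fam h

/-- the ruled leaf unfolded: the `α`-clause of the Theorem for every `0 ≤ α < 1` (proof `Iff.rfl`).
[cite: Balaban1983RegularityDecay, Theorem p. 573 (1.9)–(1.12); Hölder range 0 ≤ α < 1 per ruling G-ref1-32] -/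
theorem thmPrintedNN_iff (fam : I → EtaSetting) :
    ThmPrintedNN fam ↔
      ∀ α : ℝ, 0 ≤ α → α < 1 → ∃ δ₀ c₀ R₀ e₁ : ℝ, 0 < δ₀ ∧ 0 < c₀ ∧ 0 < R₀ ∧ 0 < e₁ ∧ ∀ i : I,
        (fam i).regular → (fam i).bigBlocks → 0 < (fam i).e → (fam i).e ≤ e₁ →
          Ineq19_110 (fam i) α δ₀ c₀ R₀ ∧ Ineq111_112 (fam i) α δ₀ c₀ R₀ :=
  Iff.rfl

/-- the `α`-clause of the ruled leaf at a given `0 ≤ α < 1`: constants `δ₀, c₀, R₀` and the smallness threshold `e₁`,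
then (1.9)–(1.12) for every member meeting the printed antecedents.
[cite: Balaban1983RegularityDecay, Theorem p. 573 (1.9)–(1.12); Hölder range 0 ≤ α < 1 per ruling G-ref1-32] -/
theorem ThmPrintedNN.clause {fam : I → EtaSetting} (h : ThmPrintedNN fam) {α : ℝ} (hα0 : 0 ≤ α) (hα1 : α < 1) :
    ∃ δ₀ c₀ R₀ e₁ : ℝ, 0 < δ₀ ∧ 0 < c₀ ∧ 0 < R₀ ∧ 0 < e₁ ∧ ∀ i : I,
      (fam i).regular → (fam i).bigBlocks → 0 < (fam i).e → (fam i).e ≤ e₁ →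
        Ineq19_110 (fam i) α δ₀ c₀ R₀ ∧ Ineq111_112 (fam i) α δ₀ c₀ R₀ :=
  h α hα0 hα1

/-- the ruled leaf implies node 12's (1.9)–(1.10) half `ThmPrinted19NN` (by name). [cite: Balaban1983RegularityDecay,
Theorem p. 573 (1.9)–(1.10); Hölder range 0 ≤ α < 1 per ruling G-ref1-32] -/
theorem ThmPrintedNN.to19 {fam : I → EtaSetting} (h : ThmPrintedNN fam) :
    B4Ineq19ZeroBoxEta.ThmPrinted19NN fam :=
  thmPrinted19NN_of_thmPrintedNN fam h

/-- **RULED READING OF LEMMA 2.4, AS A WEAKENING OF THE TYPED LEAF**: `B4.Lemma24Printed fam → B4.Lemma24PrintedNN fam`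
for every family (RULING G-ref1-32 item (2) for (2.36)). [cite: Balaban1983RegularityDecay, Lemma 2.4 (2.35)–(2.37)
p. 582; Hölder range 0 ≤ α < 1 per ruling G-ref1-32] -/
theorem Lemma24Printed.nn {fam : I → ScaleSetting} (h : Lemma24Printed fam) : Lemma24PrintedNN fam :=
  lemma24PrintedNN_of_printed fam h

/-- the `α`-free conjunct of Lemma 2.4 — (2.35) (both kernels) and (2.37) with one pair `c₀, δ₀` — is common to the
typed and the ruled leaf. [cite: Balaban1983RegularityDecay, Lemma 2.4 (2.35), (2.37) p. 582] -/
theorem Lemma24Printed.bounds235_237 {fam : I → ScaleSetting} (h : Lemma24Printed fam) :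
    ∃ c₀ δ₀ : ℝ, 0 < c₀ ∧ 0 < δ₀ ∧ ∀ i : I, (fam i).rectLarge →
      (∀ (x : (fam i).SiteF) (y : (fam i).SiteU),
          (fam i).kerGQ x y ≤ c₀ * Real.exp (-(δ₀ * (fam i).distF x y))) ∧
      (∀ (μ : (fam i).Dir) (x : (fam i).SiteF) (y : (fam i).SiteU),
          (fam i).kerDGQ μ x y ≤ c₀ * Real.exp (-(δ₀ * (fam i).distF x y))) ∧
      (∀ y y' : (fam i).SiteU, (fam i).kerC y y' ≤ c₀ * Real.exp (-(δ₀ * (fam i).distU y y'))) := by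
  obtain ⟨c₀, δ₀, hc, hδ, h1, -⟩ := h
  exact ⟨c₀, δ₀, hc, hδ, h1⟩

/-- **THE (2.36) CLAUSE ON THE RULED RANGE** `0 ≤ α < 1`, from the typed leaf: a rate `δ₀ > 0` (the leaf's common one)
and, for the given `α`, a constant `c₁ > 0` (the carver's requested projection `lemma24Printed_bound236_nn`).
[cite: Balaban1983RegularityDecay, Lemma 2.4 (2.36) p. 582; Hölder range 0 ≤ α < 1 per ruling G-ref1-32] -/
theorem Lemma24Printed.bound236_nn {fam : I → ScaleSetting} (h : Lemma24Printed fam) {α : ℝ} (_hα0 : 0 ≤ α)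
    (hα1 : α < 1) :
    ∃ δ₀ : ℝ, 0 < δ₀ ∧ ∃ c₁ : ℝ, 0 < c₁ ∧ ∀ i : I, (fam i).rectLarge →
      ∀ (μ : (fam i).Dir) (x x' : (fam i).SiteF) (y : (fam i).SiteU),
        (fam i).lhs236 α μ x x' y ≤ c₁ * Real.exp (-(δ₀ * (fam i).dist2F x x' y)) := by
  obtain ⟨c₀, δ₀, -, hδ, -, h2⟩ := h
  exact ⟨δ₀, hδ, h2 α hα1⟩

/-- the (2.36) clause of the RULED leaf at a given `0 ≤ α < 1`. [cite: Balaban1983RegularityDecay, Lemma 2.4 (2.36)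
p. 582; Hölder range 0 ≤ α < 1 per ruling G-ref1-32] -/
theorem Lemma24PrintedNN.bound236 {fam : I → ScaleSetting} (h : Lemma24PrintedNN fam) {α : ℝ} (hα0 : 0 ≤ α)
    (hα1 : α < 1) :
    ∃ δ₀ : ℝ, 0 < δ₀ ∧ ∃ c₁ : ℝ, 0 < c₁ ∧ ∀ i : I, (fam i).rectLarge →
      ∀ (μ : (fam i).Dir) (x x' : (fam i).SiteF) (y : (fam i).SiteU),
        (fam i).lhs236 α μ x x' y ≤ c₁ * Real.exp (-(δ₀ * (fam i).dist2F x x' y)) := by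
  obtain ⟨c₀, δ₀, -, hδ, -, h2⟩ := h
  exact ⟨δ₀, hδ, h2 α hα0 hα1⟩

end Projections

/-! ## §3 The ruling's ledger at zero field, BY NAME (pv17 nodes 13, 16, 17, 18; nodes 21, 22) -/

section Ledger

variable {d ℓ : ℕ} {m2plus : ℝ}

/-- **RULING G-ref1-32 AT ZERO FIELD ON THE NESTED-BOX FAMILY `Ω ⊂ Ω₀`** (every `L = ℓ + 1 ≥ 2`, `a > 0`, mass window
`[0, m²₊]`, big-block size `Mb ≥ 1`, boundary assignment `0 ≤ g ≤ dist_η(supp f, Ω₀∖Ω)`): the RULED reading holds on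
the bond carrier — `ThmPrintedNN (nestFam …)` (node 13 `thmPrintedNN_nestFam`) — while on b04's verbatim
site-difference carrier `nestFamB` both the ruled-range leaf and the typed leaf FAIL (node 17
`not_thmPrintedNN_nestFamB`, `not_thmPrinted_nestFamB`: the unguarded `δG`-Hölder field at an interior face of `Ω`).
Item (1) of the ruling, located in the kernel. [cite: Balaban1983RegularityDecay, Theorem p. 573 (1.9)–(1.12), case
A = 0, Ω ⊂ Ω₀ nested boxes; carrier and range per ruling G-ref1-32] -/
theorem ruling_thm573_nestFam (hℓ : 1 ≤ ℓ) (hm2 : 0 ≤ m2plus) {a : ℝ} (ha : 0 < a) {Mb : ℕ} (hMb : 1 ≤ Mb)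
    {g : ∀ i : ZeroFieldInstance d, (↥i.R → ℝ) → ℝ} (hg0 : ∀ i f, 0 ≤ g i f)
    (hg1 : ∀ (i : ZeroFieldInstance d) (f : ↥i.R → ℝ),
      (outR i.R i.R₀).Nonempty → (supp f).Nonempty → g i f ≤ bdist i.n i.hsub f) :
    ThmPrintedNN (nestFam (d := d) ℓ m2plus a Mb g) ∧
      ¬ ThmPrintedNN (nestFamB (d := d) ℓ m2plus a Mb g) ∧
      ¬ ThmPrinted (nestFamB (d := d) ℓ m2plus a Mb g) :=
  ⟨thmPrintedNN_nestFam hℓ a ha Mb hg1, not_thmPrintedNN_nestFamB hℓ hm2 ha hMb hg0,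
    not_thmPrinted_nestFamB hℓ hm2 ha hMb hg0⟩

/-- the same with b04's default boundary assignment `g = dist_η(supp f, Ω₀∖Ω)` (admissible and nonnegative by name).
[cite: Balaban1983RegularityDecay, Theorem p. 573 (1.9)–(1.12), case A = 0, Ω ⊂ Ω₀ nested boxes; carrier and range
per ruling G-ref1-32] -/
theorem ruling_thm573_nestFam_std (hℓ : 1 ≤ ℓ) (hm2 : 0 ≤ m2plus) {a : ℝ} (ha : 0 < a) {Mb : ℕ} (hMb : 1 ≤ Mb) :
    ThmPrintedNN (nestFam (d := d) ℓ m2plus a Mb fun i f => bdist i.n i.hsub f) ∧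
      ¬ ThmPrintedNN (nestFamB (d := d) ℓ m2plus a Mb fun i f => bdist i.n i.hsub f) ∧
      ¬ ThmPrinted (nestFamB (d := d) ℓ m2plus a Mb fun i f => bdist i.n i.hsub f) :=
  ruling_thm573_nestFam hℓ hm2 ha hMb (fun i f => bdist_nonneg i f) bdist_admissible

/-- **RULING G-ref1-32, ITEM (2), AT ZERO FIELD ON THE BOX FAMILY**: the LITERAL typed leaf `B4.ThmPrinted`
(«∀ α < 1») FAILS in BOTH conventions (node 16: the instance `α = −1`), while the ruled-range (1.9)–(1.10) half holds
on the bond carrier (node 12 `thmPrinted19NN_boxFam`). [cite: Balaban1983RegularityDecay, Theorem p. 573, case A = 0,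
Ω a box; range per ruling G-ref1-32] -/
theorem ruling_thm573_boxFam (hℓ : 1 ≤ ℓ) (hm2 : 0 ≤ m2plus) {a : ℝ} (ha : 0 < a) {Mb : ℕ} (hMb : 1 ≤ Mb)
    (g : ∀ i : ZeroFieldInstance d, (↥i.R → ℝ) → ℝ) :
    B4Ineq19ZeroBoxEta.ThmPrinted19NN (boxFam ℓ m2plus a Mb g) ∧
      ¬ ThmPrinted (boxFam ℓ m2plus a Mb g) ∧ ¬ ThmPrinted (boxFamB ℓ m2plus a Mb g) :=
  ⟨thmPrinted19NN_boxFam hℓ a ha Mb g, not_thmPrinted_boxFam hℓ hm2 ha hMb g, not_thmPrinted_boxFamB hℓ hm2 ha hMb g⟩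

/-- **RULING G-ref1-32 OVER b04's OWN INDEX** (all zero-field instances `Ω ⊂ Ω₀`, every `a > 0`, `Mb ≥ 1`, `g ≥ 0`):
the typed leaf fails in both conventions (range defect, node 16) and the ruled-range leaf fails on the verbatim
carrier (carrier defect, node 17). [cite: Balaban1983RegularityDecay, Theorem p. 573, case A = 0; carrier and range
per ruling G-ref1-32] -/
theorem ruling_thm573_allInstances {a : ℝ} (ha : 0 < a) {Mb : ℕ} (hMb : 1 ≤ Mb)
    {g : ∀ i : ZeroFieldInstance d, (↥i.R → ℝ) → ℝ} (hg0 : ∀ i f, 0 ≤ g i f) :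
    ¬ ThmPrinted (zeroFieldSettingBond a Mb g : ZeroFieldInstance d → EtaSetting) ∧
      ¬ ThmPrinted (zeroFieldSettingB a Mb g : ZeroFieldInstance d → EtaSetting) ∧
      ¬ ThmPrintedNN (zeroFieldSettingB a Mb g : ZeroFieldInstance d → EtaSetting) :=
  ⟨not_thmPrinted_zeroFieldSettingBond ha hMb g, not_thmPrinted_zeroFieldSettingB ha hMb g,
    not_thmPrintedNN_zeroFieldSettingB ha hMb hg0⟩

/-- **THE CONVENTION TRANSFER** (node 18, every index of zero-field instances, every `α`, same constants): the
ruled-range leaf on b04's verbatim carrier IMPLIES it on the ruled bond carrier (the guarded Hölder quotient is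
pointwise `≤` the unguarded one). [cite: Balaban1983RegularityDecay, Theorem p. 573 (1.9)–(1.12), case A = 0;
carrier per ruling G-ref1-32] -/
theorem ruling_thm573_transfer {I : Type} (φ : I → ZeroFieldInstance d) (a : ℝ) (Mb : ℕ)
    (g : ∀ i : ZeroFieldInstance d, (↥i.R → ℝ) → ℝ) :
    (ThmPrintedNN (fun j => zeroFieldSettingB a Mb g (φ j)) → ThmPrintedNN (fun j => zeroFieldSettingBond a Mb g (φ j)))
      ∧ (ThmPrinted (fun j => zeroFieldSettingB a Mb g (φ j)) →
          ThmPrinted (fun j => zeroFieldSettingBond a Mb g (φ j))) :=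
  ⟨thmPrintedNN_bond_of_B φ a Mb g, thmPrinted_bond_of_B φ a Mb g⟩

/-- **RULING G-ref1-32, ITEM (2), FOR LEMMA 2.4 AT ZERO FIELD** (the box family of `B4.ScaleSetting`, every window
`0 < a₋ ≤ a₊`, `0 ≤ m²₊`, `0 < a₂₋ ≤ a₂₊`, every `L ≥ 2`, every dimension): the RULED leaf `Lemma24PrintedNN` HOLDS
(node 21 `lemma24PrintedNN_zeroFieldScales`) and the typed leaf `B4.Lemma24Printed` FAILS (node 22, `α = −1`).
[cite: Balaban1983RegularityDecay, Lemma 2.4 (2.35)–(2.37) p. 582, case A = 0; range per ruling G-ref1-32] -/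
theorem ruling_lemma24_zeroFieldScales (d : ℕ) {ℓ : ℕ} (hℓ : 1 ≤ ℓ)
    {aminus aplus m2plus a2minus a2plus : ℝ} (ha : 0 < aminus) (ha' : aminus ≤ aplus) (hm2 : 0 ≤ m2plus)
    (ha2 : 0 < a2minus) (ha2' : a2minus ≤ a2plus) :
    Lemma24PrintedNN (zeroFieldScales d ℓ aminus aplus m2plus a2minus a2plus) ∧
      ¬ Lemma24Printed (zeroFieldScales d ℓ aminus aplus m2plus a2minus a2plus) :=
  ⟨lemma24PrintedNN_zeroFieldScales d ℓ hℓ ha ha2, not_lemma24Printed_zeroFieldScales d ℓ ha ha' hm2 ha2'⟩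

end Ledger

/-! ## §4 Non-vacuity (`d + 1 = 4`, `L = 2`, `a = 1`, `m²₊ = 0`, `Mb = 1`; Lemma 2.4: window `[1/2,2]×[0,1]×[1/2,2]`) -/

/-- the ruled names resolve under `B4` and the nested-box ledger is inhabited in four dimensions. -/
example : ThmPrintedNN (nestFam (d := 3) 1 0 1 1 fun i f => bdist i.n i.hsub f) ∧
    ¬ ThmPrintedNN (nestFamB (d := 3) 1 0 1 1 fun i f => bdist i.n i.hsub f) ∧
    ¬ ThmPrinted (nestFamB (d := 3) 1 0 1 1 fun i f => bdist i.n i.hsub f) :=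
  ruling_thm573_nestFam_std le_rfl le_rfl one_pos le_rfl

/-- the Lemma 2.4 ledger in four dimensions. -/
example : Lemma24PrintedNN (zeroFieldScales 3 1 (1 / 2) 2 1 (1 / 2) 2) ∧
    ¬ Lemma24Printed (zeroFieldScales 3 1 (1 / 2) 2 1 (1 / 2) 2) :=
  ruling_lemma24_zeroFieldScales 3 le_rfl (by norm_num) (by norm_num) (by norm_num) (by norm_num) (by norm_num)

/-- the typed leaf projects onto the ruled one (dot notation on the printed name). -/
example {I : Type} (fam : I → EtaSetting) (h : ThmPrinted fam) : ThmPrintedNN fam := h.nn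

end Literature.MathematicalPhysics.QuantumFieldTheory.Balaban1983to89.B4
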